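/-
HONEST FRAMING: certified error envelopes and provably optimal rounding/accumulation schemes for
low-precision formats under stated cost models; every table by two implementations; no hardware
or vendor claims.
-/
import Summits.Ventures.CertifiedArithmetic.LowPrec.OptDemotionBudgetCert
import Summits.Ventures.CertifiedArithmetic.LowPrec.OptDemotionBudgetCertQ5

/-!
# The demotion law (Theorem T8), part 7e: Statement-style R4 propositions for parts 7b′–7d′

Same shape as `LowPrec/OptTreeR4.lean` / `R4_DemotionLawEveryTree` (part 5f): the relaxation
theorem and the certified classes of Conjecture D as named `Prop`s with their `_holds` discharges,
for the venture's rung bookkeeping (OPTIMA.md §B T8(b)(iii′)/(iii), COST-MODELS CM-B).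
-/

namespace Summit.Ventures.CertifiedArithmetic.LowPrec.Opt

open Literature.ComputerArithmetic.JeannerodRump2018
open Literature.ComputerArithmetic.JeannerodRump2018.SumTree

/-- R4 (Opt, CM-B demote, OPTIMA T8(b)(iii′)(R1)) THE RELAXATION THEOREM: for every precision `q ≥ 1`,
every nearest rounding `fl` into `F(q, emin)` and every summation tree of nonnegative floats, the
exact sum is at most the budget relaxation `Φ*` of the tree's shape at the computed value:
`eval = 0 ⟹ exact ≤ 0` and `eval = v > 0 ⟹ exact ≤ 2^(⌊log₂ v⌋+1-q) · Φ*_(shape)(mant v)`. -/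
def R4_BudgetRelaxation : Prop :=
  ∀ (q : ℕ) (emin : ℤ) (fl : ℚ → ℚ), 1 ≤ q → IsRoundNearest q emin fl →
    ∀ t : SumTree, (∀ x ∈ leaves t, IsFloat q emin x ∧ 0 ≤ x) →
      (eval fl t = 0 → exact t ≤ 0) ∧
      (0 < eval fl t → exact t ≤
        (2 : ℚ) ^ (Int.log 2 (eval fl t) + 1 - q) * phi q (shapeOf t) (mant q (eval fl t)))

/-- Discharge of `R4_BudgetRelaxation` by `exact_le_phi` (part 7b′). -/
theorem R4_BudgetRelaxation_holds : R4_BudgetRelaxation :=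
  fun _ _ _ hq hfl t ht => exact_le_phi hq hfl t ht

/-- R4 (Opt, CM-B demote, OPTIMA T8(b)(iii)) CONJECTURE D FROM THE CERTIFICATE: for `1 ≤ p`,
`p + 1 ≤ q`, any nearest roundings into `F(q, emin)` and `F(p, emin)`, every summation tree of
nonnegative `F(q, emin)` data whose shape passes the kernel-decidable check `budgetCheck q p`
satisfies `s ≤ Q_t · fl_p(ŝ)` (`Q_t = treeQf u_q t u_p`). -/
def R4_DemotionLawOfCertificate : Prop :=
  ∀ (q p : ℕ) (emin : ℤ) (fl flp : ℚ → ℚ), 1 ≤ p → p + 1 ≤ q →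
    IsRoundNearest q emin fl → IsRoundNearest p emin flp →
    ∀ t : SumTree, (∀ x ∈ leaves t, IsFloat q emin x ∧ 0 ≤ x) → budgetCheck q p (shapeOf t) = true →
      exact t ≤ treeQf (unitRoundoff q) t (unitRoundoff p) * flp (eval fl t)

/-- Discharge of `R4_DemotionLawOfCertificate` by `exact_le_treeQf_mul_fl_of_budgetCheck` (part 7c). -/
theorem R4_DemotionLawOfCertificate_holds : R4_DemotionLawOfCertificate :=
  fun _ _ _ _ _ hp hpq hfl hflp t ht hc => exact_le_treeQf_mul_fl_of_budgetCheck hp hpq hfl hflp t ht hc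

/-- R4 (Opt, CM-B demote, OPTIMA T8(b)(iii)) CONJECTURE D ON THE KERNEL-CERTIFIED CLASSES: any
nearest roundings, any nonnegative data — (q,p) = (4,2): EVERY summation tree with at most 7 summands;
(5,3) and (5,2): every tree with at most 5 summands; and every tree of the shape of opt gen 11's
37-leaf GOOD-ACTIVE failure `opt37` at (4,2) and of the 43-leaf `gaCex43` at (5,3).  (With the
every-tree witness `demotion_tree_witness` of part 4 these are exact: `D_t = Q_t`.) -/
def R4_DemotionLawCertified : Prop :=
  (∀ (emin : ℤ) (fl flp : ℚ → ℚ), IsRoundNearest 4 emin fl → IsRoundNearest 2 emin flp →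
    ∀ t : SumTree, (∀ x ∈ leaves t, IsFloat 4 emin x ∧ 0 ≤ x) → (leaves t).length ≤ 7 →
      exact t ≤ treeQf (unitRoundoff 4) t (unitRoundoff 2) * flp (eval fl t)) ∧
  (∀ (emin : ℤ) (fl flp : ℚ → ℚ), IsRoundNearest 5 emin fl → IsRoundNearest 3 emin flp →
    ∀ t : SumTree, (∀ x ∈ leaves t, IsFloat 5 emin x ∧ 0 ≤ x) → (leaves t).length ≤ 5 →
      exact t ≤ treeQf (unitRoundoff 5) t (unitRoundoff 3) * flp (eval fl t)) ∧
  (∀ (emin : ℤ) (fl flp : ℚ → ℚ), IsRoundNearest 5 emin fl → IsRoundNearest 2 emin flp →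
    ∀ t : SumTree, (∀ x ∈ leaves t, IsFloat 5 emin x ∧ 0 ≤ x) → (leaves t).length ≤ 5 →
      exact t ≤ treeQf (unitRoundoff 5) t (unitRoundoff 2) * flp (eval fl t)) ∧
  (∀ (emin : ℤ) (fl flp : ℚ → ℚ), IsRoundNearest 4 emin fl → IsRoundNearest 2 emin flp →
    ∀ t : SumTree, (∀ x ∈ leaves t, IsFloat 4 emin x ∧ 0 ≤ x) → shapeOf t = shapeOf opt37 →
      exact t ≤ treeQf (unitRoundoff 4) t (unitRoundoff 2) * flp (eval fl t)) ∧
  (∀ (emin : ℤ) (fl flp : ℚ → ℚ), IsRoundNearest 5 emin fl → IsRoundNearest 3 emin flp →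
    ∀ t : SumTree, (∀ x ∈ leaves t, IsFloat 5 emin x ∧ 0 ≤ x) → shapeOf t = shapeOf gaCex43 →
      exact t ≤ treeQf (unitRoundoff 5) t (unitRoundoff 3) * flp (eval fl t))

/-- Discharge of `R4_DemotionLawCertified` by the kernel certificates of parts 7d and 7d′. -/
theorem R4_DemotionLawCertified_holds : R4_DemotionLawCertified :=
  ⟨fun _ _ _ hfl hflp t ht hn => conjectureD_4_2_of_le_seven hfl hflp t ht hn,
   fun _ _ _ hfl hflp t ht hn => conjectureD_5_3_of_le_five hfl hflp t ht hn,
   fun _ _ _ hfl hflp t ht hn => conjectureD_5_2_of_le_five hfl hflp t ht hn,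
   fun _ _ _ hfl hflp t ht hs => conjectureD_opt37 hfl hflp t ht hs,
   fun _ _ _ hfl hflp t ht hs => conjectureD_gaCex43 hfl hflp t ht hs⟩

end Summit.Ventures.CertifiedArithmetic.LowPrec.Opt
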